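/- Width seat `ym-line-sfw-p2-w5` (prover-ym-line-sfw-p2-w5-g19-0), free hands on planner ym-idea-2 g17's typed task T-U2.S
(`Cruxes/BoxWindowHighSU2213/TaskU2S.lean`, STUB-PLAN-U2 rev 2 §3) for LINE-20 «landau-rung3» stub U2 on ⟨stmt-QuantumFields-24336⟩. -/
import Summits.QuantumFields.YangMills.Theorems.AllWindowsColdBoxBoxHighLineUniformGaugeRoot

/-!
# T-U2.S («uniformised temporal gauge»), part 2: the task Props (verbatim) and the uniformising gauge transform — definitions

* `UniformGaugeBound`, `SharpStageI` — the two Props of the planner's typed task `Cruxes/BoxWindowHighSU2213/TaskU2S.lean` (ym-idea-2 g17,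
  commit a5e121006697), copied VERBATIM into the line namespace `…Theorems.AllWindowsColdBoxBoxHighLine` as the planner asked («a taker copies the
  Prop(s) verbatim into a Theorems LineDefs append … and proves them»; a separate small defs module, so that LINE-20's `…BoxWindowHighSU2213LineDefs`
  is not re-submitted under the append-only rule while its owner works on it);
* `UniformGauge.col x` — the bottom-face projection of a site (`x₀ ↦ 0`), so that `forestFix H U (col x, 0)` is the COLUMN HOLONOMY `h_y` of the
  temporal forest gauge through `x` (the bottom temporal link carries the whole column product: `forestFix_forest`);
* `UniformGauge.spreadGauge H U x = kroot (2H) h_y ^ (2H − x₀)` at interior `x` (else `1`) — the interior gauge transform that spreads `h_y` evenly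
  over the `2H` temporal links of its column (each becomes `kroot (2H) h_y`, STUB-PLAN-U2 §3.3), and `UniformGauge.uniformGauge = spreadGauge · forestGauge`.

Definitions only (two `Prop`s verbatim from the task file + three explicit functions); the proofs (`uniformGaugeBound : UniformGaugeBound`,
`sharpStageI : SharpStageI`) are in the sibling `…UniformTemporalGauge`.  HONEST LABEL: bookkeeping for the typed task T-U2.S of an OPEN stub (U2) of a
critic-PASSed DRAFT-by-design line on the R2ξ″ RECORD-rung crux ⟨24336⟩; nothing is proved here; no crux, rung or summit is proved; the Yang–Mills mass
gap is NOT proved by this file.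
-/

set_option autoImplicit false

noncomputable section

open Literature.MathematicalPhysics.QuantumFieldTheory
open Literature.MathematicalPhysics.QuantumFieldTheory.LatticeMaxwell
open Literature.MathematicalPhysics.QuantumFieldTheory.AxialGauge
open Summit.QuantumFields.YangMills.Theorems.WeakCouplingRates

namespace Summit.QuantumFields.YangMills.Theorems.AllWindowsColdBoxBoxHighLine

/-- **T-U2.S (uniform gauge bound, sharp Stage I)** — VERBATIM from `Cruxes/BoxWindowHighSU2213/TaskU2S.lean`.  Proof sketch: temporal forest gauge
(spatial links within `C·H·s`, interior temporal links `= 1`, bottom temporal links `((0,y),0)` carry the column holonomy `h_y`, `‖h_y − 1‖ ≲ H²s < 1/2`);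
then `g(x₀,y) := k_y^{2H−x₀}` with `k_y := h_y^{1/(2H)}` makes every temporal link of column `y` equal to `k_y` (deviation `≤ C·H·s`) and moves spatial
links by `‖h_y^t − h_{y+μ̂}^t‖ ≤ C‖h_y − h_{y+μ̂}‖ ≤ C'·H·s`. -/
def UniformGaugeBound : Prop :=
  ∃ C c : ℝ, 0 < C ∧ 0 < c ∧ ∀ H : ℕ, 1 ≤ H → ∀ s : ℝ, 0 ≤ s → s * (H : ℝ) ^ 2 ≤ c →
    ∀ U : Literature.MathematicalPhysics.QuantumLattice.LGConfig 4 SU2, ColdWall H U → SmallPlaquettes H s U →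
      InGaugeBall H (C * H * s) U

/-- The arithmetic consequence used by the bootstrap — VERBATIM from `Cruxes/BoxWindowHighSU2213/TaskU2S.lean`: a per-link radius `C·H·s` gives
total defect `≤ 4(2H+1)⁴·(C·H·s)²` over the box links (`card (boxEdges 4 (2H+1)) ≤ 4(2H+1)⁴` is ✓`card_boxEdges_four_le`). -/
def SharpStageI : Prop :=
  ∃ C c : ℝ, 0 < C ∧ 0 < c ∧ ∀ H : ℕ, 1 ≤ H → ∀ s : ℝ, 0 ≤ s → s * (H : ℝ) ^ 2 ≤ c →
    ∀ U : Literature.MathematicalPhysics.QuantumLattice.LGConfig 4 SU2, ColdWall H U → SmallPlaquettes H s U →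
      ∃ g : Literature.Probability.LatticeModels.Site 4 → SU2, IsInteriorGauge H g ∧
        (∑ e ∈ boxEdges 4 (2 * H + 1), linkDefect (Literature.MathematicalPhysics.QuantumLattice.gaugeTransformZd g U) e) ≤
          C * (H : ℝ) ^ 6 * s ^ 2

namespace UniformGauge

open Literature.Probability.LatticeModels (Site)
open Literature.MathematicalPhysics.QuantumLattice

/-- The bottom-face projection of a site: the time coordinate set to `0` (the base point of the column through `x`). -/
def col (x : Site 4) : Site 4 := Function.update x 0 0

/-- **The spreading gauge transform** (interior; `1` elsewhere): at an interior site `x = (x₀, y)` it is `k_y ^ (2H − x₀)` with `k_y = kroot (2H) h_y` the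
principal `2H`-th root of the column holonomy `h_y = forestFix H U ((0,y), e₀)` of the temporal forest gauge. -/
def spreadGauge (H : ℕ) (U : LGConfig 4 SU2) (x : Site 4) : SU2 :=
  if (∀ k : Fin 4, 1 ≤ x k ∧ x k + 1 ≤ 2 * (H : ℤ)) then
    kroot (2 * H) (forestFix H U (col x, 0)) ^ (2 * H - (x 0).toNat) else 1

/-- **The uniformising gauge transform** `spreadGauge · forestGauge`: first the temporal forest gauge, then the spreading of the column holonomies. -/
def uniformGauge (H : ℕ) (U : LGConfig 4 SU2) (x : Site 4) : SU2 := spreadGauge H U x * forestGauge H U x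

end UniformGauge

end Summit.QuantumFields.YangMills.Theorems.AllWindowsColdBoxBoxHighLine

end
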